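import Mathlib
import Summits.Ventures.PercRepro2.Defs
import Summits.Ventures.PercRepro2.Independence
import Summits.Ventures.PercRepro2.Harris
import Summits.Ventures.PercRepro2.Graph
import Summits.Ventures.PercRepro2.Exploration
import Summits.Ventures.PercRepro2.Events
import Summits.Ventures.PercRepro2.FourFunctions
import Summits.Ventures.PercRepro2.Induced
import Summits.Ventures.PercRepro2.Frontier
import Summits.Ventures.PercRepro2.ObsIndependence
import Summits.Ventures.PercRepro2.BHK
import Summits.Ventures.PercRepro2.BHKEvents
import Summits.Ventures.PercRepro2.MultiSource
import Summits.Ventures.PercRepro2.OrderPreservation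
import Summits.Ventures.PercRepro2.SeedSet
import Summits.Ventures.PercRepro2.MultiSourceFun
import Summits.Ventures.PercRepro2.CrossRootT
import Summits.Ventures.PercRepro2.VdBKahn
import Summits.Ventures.PercRepro2.LemmaA
import Summits.Ventures.PercRepro2.GateDefs
import Summits.Ventures.PercRepro2.GateFrame
import Summits.Ventures.PercRepro2.GateSFrame

/-!
# THEOREM (DUAL MARKER GATE): `GateRow A {b}` for every `A` (blind cell PercRepro2, typer-1;
mine-c g6 MINE-C.md §13.10, INBOX 2026-08-23T16:35:15Z; lead g11 16:49:24Z "GateRow_markerB … before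
the VTX↔ConW split")

For the marker `b` of `Y = {b ∈ C(s)}` and ANY `A`, `Φ(R_T ∖ {S hits A ∧ b ∈ hull(T)}) ≥ 0`.
On `R = R_T` the clusters `S = C(s)` and `K = hull(T)` are disjoint, so `Y = 0` on the removed
class: `P(XY; G) = xy`, `P(Y; G) = y`, `P(X; G) = x − xk + xkA`, `P(G) = r − kb + kA`
(`xk = P(X; R, b ∈ K)`, `kb = P(R, b ∈ K)`, `xkA = P(X; R_{T∪A}, b ∈ K)`, `kA = P(R_{T∪A}, b ∈ K)`), and
the cleared `Φ` is EXACTLY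

  `Φ = r · [(r − kb) xy − (x − xk) y] + kb · (r xy − x y) + y · (x kA − r xkA)`   (`gate_dual_identity`)

— three nonnegative terms: the first is the hull-frame positive association of `X, Y` given
`R ∩ {K avoids b}` (`GateFrame.hull_frame_pa` at `B = {b}`), the second is BHK 1.3 (`vdBK`), the third
is mine-c's chain `E[X | b ∈ K, S avoids A] ≤ E[X | S avoids A] ≤ E[X]` (given `R`): the S-FRAME
step `sframe_step` — explore `S = C(s)`; given `S = W` the marker event is `1[a ∈ W]` (increasing)
and `{b ∈ K}` has probability `κ_b(W) = P(b ↔ T in G − W)` (decreasing: `delClusterProb_anti`), so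
the seed-set BHK `bhk_multi` with seed `{s}` and avoided set `T ∪ A ∪ {b}` (through the tower
identity `prob_clusterSetIn_inter_eq_expect`) gives `P(X, b ∈ K; R₁) P(R₁) ≤ P(X; R₁) P(b ∈ K; R₁)`
— and two avoided-set shifts (`LemmaA.shift_avoid_more`, `T ∪ A ⊆ T ∪ A ∪ {b}` and `T ⊆ T ∪ A`).
mine-c's warning is respected: the naive `E[X | b ∈ K, S avoids A] ≤ E[X | b ∈ K]` is FALSE; the
proof goes through the S-frame.

* **`GateRow_dual`**: `GateRow p ends s T a b A {b}` for every admissible `p` and every `A`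
  (hypothesis: `b ∉ T`, which the row's scope `B ⊆ V ∖ (T ∪ {s})` provides); `GateRow_dual'` for
  `A {a}`. With `GateRow_marker` (`{a} B`, `{b} B`): (GATE A,B) is a THEOREM whenever one side is a
  single marker.
-/

namespace Summit.Ventures.PercRepro2

namespace Gate

open scoped Classical

variable {V : Type*} {E : Type*} [Fintype E] [DecidableEq E] [Fintype V] [DecidableEq V]
  {R : Type*} [Field R] [LinearOrder R] [IsStrictOrderedRing R]

/-! ## The theorem -/

section Main

variable (p : E → R) (ends : E → Sym2 V) (s : V) (T A : Finset V) (a b : V)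

omit [Fintype E] [DecidableEq E] [Fintype V] [LinearOrder R] [IsStrictOrderedRing R] in
/-- `XY ∩ gate = XY ∩ R` (on `R`, `b ∈ C(s)` excludes `b ∈ K`). -/
lemma XY_inter_gate_dual_eq :
    connAll ends s ({a} ∪ {b}) ∩ gateEvent ends s T A {b} =
      connAll ends s ({a} ∪ {b}) ∩ avoidAll ends s T := by
  ext ω
  simp only [gateEvent, connAll_pair_eq, Set.mem_inter_iff, Set.mem_compl_iff, not_and]
  constructor
  · rintro ⟨⟨ha, hb⟩, hR, _⟩; exact ⟨⟨ha, hb⟩, hR⟩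
  · rintro ⟨⟨ha, hb⟩, hR⟩
    exact ⟨⟨ha, hb⟩, hR, fun _ hK => Y_inter_avoid_subset ends s T b ⟨hb, hR⟩ hK⟩

omit [Fintype E] [DecidableEq E] [Fintype V] [DecidableEq V] [LinearOrder R] [IsStrictOrderedRing R] in
/-- `Y ∩ gate = Y ∩ R`. -/
lemma Y_inter_gate_dual_eq :
    connAll ends s {b} ∩ gateEvent ends s T A {b} = connAll ends s {b} ∩ avoidAll ends s T := by
  ext ω
  simp only [gateEvent, Set.mem_inter_iff, Set.mem_compl_iff, not_and]
  constructor
  · rintro ⟨hb, hR, _⟩; exact ⟨hb, hR⟩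
  · rintro ⟨hb, hR⟩
    exact ⟨hb, hR, fun _ hK => Y_inter_avoid_subset ends s T b ⟨hb, hR⟩ hK⟩

omit [Fintype E] [DecidableEq E] [Fintype V] in
/-- `X ∩ R ∩ {b ∈ K} ∩ {S avoids A} = X ∩ {b ∈ K} ∩ R_{T ∪ A}`. -/
lemma X_hits_gate_part_eq :
    connAll ends s {a} ∩ avoidAll ends s T ∩ hitsK ends T {b} ∩ (hitsS ends s A)ᶜ =
      connAll ends s {a} ∩ hitsK ends T {b} ∩ avoidAll ends s (T ∪ A) := by
  rw [hitsS_eq_compl, compl_compl, avoidAll_union_eq]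
  ext ω
  simp only [Set.mem_inter_iff]
  tauto

omit [Fintype V] [LinearOrder R] [IsStrictOrderedRing R] in
/-- `P(X; gate) = P(X; R) − P(X, b ∈ K; R) + P(X, b ∈ K; R_{T ∪ A})`. -/
lemma prob_X_inter_gate_dual :
    prob p (connAll ends s {a} ∩ gateEvent ends s T A {b}) =
      prob p (connAll ends s {a} ∩ avoidAll ends s T) -
        prob p (connAll ends s {a} ∩ hitsK ends T {b} ∩ avoidAll ends s T) +
        prob p (connAll ends s {a} ∩ hitsK ends T {b} ∩ avoidAll ends s (T ∪ A)) := by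
  have hsplit := prob_inter_add_prob_inter_compl p (connAll ends s {a} ∩ gateEvent ends s T A {b})
    (hitsK ends T {b})
  have e1 : connAll ends s {a} ∩ gateEvent ends s T A {b} ∩ hitsK ends T {b} =
      connAll ends s {a} ∩ hitsK ends T {b} ∩ avoidAll ends s (T ∪ A) := by
    rw [← X_hits_gate_part_eq]
    ext ω
    simp only [gateEvent, Set.mem_inter_iff, Set.mem_compl_iff, not_and]
    tauto
  have e2 : connAll ends s {a} ∩ gateEvent ends s T A {b} ∩ (hitsK ends T {b})ᶜ =
      connAll ends s {a} ∩ avoidAll ends s T ∩ (hitsK ends T {b})ᶜ := by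
    ext ω
    simp only [gateEvent, Set.mem_inter_iff, Set.mem_compl_iff, not_and]
    tauto
  have hsplit2 := prob_inter_add_prob_inter_compl p (connAll ends s {a} ∩ avoidAll ends s T)
    (hitsK ends T {b})
  have e3 : connAll ends s {a} ∩ avoidAll ends s T ∩ hitsK ends T {b} =
      connAll ends s {a} ∩ hitsK ends T {b} ∩ avoidAll ends s T := by
    ext ω; simp only [Set.mem_inter_iff]; tauto
  rw [e1, e2] at hsplit
  rw [e3] at hsplit2
  linear_combination hsplit2 - hsplit

omit [Fintype V] [LinearOrder R] [IsStrictOrderedRing R] in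
/-- `P(gate) = P(R) − P(b ∈ K; R) + P(b ∈ K; R_{T ∪ A})`. -/
lemma prob_gate_dual :
    prob p (gateEvent ends s T A {b}) =
      prob p (avoidAll ends s T) - prob p (hitsK ends T {b} ∩ avoidAll ends s T) +
        prob p (hitsK ends T {b} ∩ avoidAll ends s (T ∪ A)) := by
  have hsplit := prob_inter_add_prob_inter_compl p (gateEvent ends s T A {b}) (hitsK ends T {b})
  have e1 : gateEvent ends s T A {b} ∩ hitsK ends T {b} =
      hitsK ends T {b} ∩ avoidAll ends s (T ∪ A) := by
    rw [avoidAll_union_eq, ← compl_compl (avoidAll ends s A), ← hitsS_eq_compl]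
    ext ω
    simp only [gateEvent, Set.mem_inter_iff, Set.mem_compl_iff, not_and]
    tauto
  have e2 : gateEvent ends s T A {b} ∩ (hitsK ends T {b})ᶜ =
      avoidAll ends s T ∩ (hitsK ends T {b})ᶜ := by
    ext ω
    simp only [gateEvent, Set.mem_inter_iff, Set.mem_compl_iff, not_and]
    tauto
  have hsplit2 := prob_inter_add_prob_inter_compl p (avoidAll ends s T) (hitsK ends T {b})
  rw [Set.inter_comm (avoidAll ends s T) (hitsK ends T {b})] at hsplit2
  rw [e1, e2] at hsplit
  linear_combination hsplit2 - hsplit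

omit [DecidableEq V] [LinearOrder R] [IsStrictOrderedRing R] in
/-- **The exact identity** of the dual marker gate. -/
lemma gate_dual_identity (r x y xy xk kb xkA kA : R) :
    r ^ 2 * xy - r * (x * y + y * (x - xk + xkA)) + x * y * (r - kb + kA) =
      r * ((r - kb) * xy - (x - xk) * y) + kb * (r * xy - x * y) + y * (x * kA - r * xkA) := by
  ring

omit [Fintype E] [DecidableEq E] [Fintype V] in
/-- On `R_T`, `b ∈ K` forces `b ∉ C(s)`: `{b ∈ K} ∩ R_{T ∪ A} ⊆ R_{T ∪ A ∪ {b}}`. -/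
lemma hits_avoid_subset :
    hitsK ends T {b} ∩ avoidAll ends s (T ∪ A) ⊆ avoidAll ends s (T ∪ A ∪ {b}) := by
  rintro ω ⟨hK, hR⟩
  rw [mem_avoid_union_singleton_iff]
  refine ⟨hR, ?_⟩
  intro t ht x hx hc
  rw [Finset.mem_singleton] at ht hx
  subst ht; subst hx
  obtain ⟨w, hw, t', ht', hc'⟩ := hK
  rw [Finset.mem_singleton] at hw
  subst hw
  exact hR t' (Finset.mem_union_left _ ht') (conn_trans hc (conn_symm hc'))

/-- **THEOREM (DUAL MARKER GATE)** (mine-c §13.10): `GateRow p ends s T a b A {b}` for every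
admissible `p` and every `A` — the gate removing the class `{S hits A ∧ b ∈ K}` keeps the centred
rung nonnegative. -/
theorem GateRow_dual (hp : IsProbVec p) : GateRow p ends s T a b A {b} := by
  unfold GateRow
  rw [XY_inter_gate_dual_eq, Y_inter_gate_dual_eq, prob_X_inter_gate_dual, prob_gate_dual]
  set r := prob p (avoidAll ends s T) with hr
  set x := prob p (connAll ends s {a} ∩ avoidAll ends s T) with hx
  set y := prob p (connAll ends s {b} ∩ avoidAll ends s T) with hy
  set xy := prob p (connAll ends s ({a} ∪ {b}) ∩ avoidAll ends s T) with hxy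
  set xk := prob p (connAll ends s {a} ∩ hitsK ends T {b} ∩ avoidAll ends s T) with hxk
  set kb := prob p (hitsK ends T {b} ∩ avoidAll ends s T) with hkb
  set xkA := prob p (connAll ends s {a} ∩ hitsK ends T {b} ∩ avoidAll ends s (T ∪ A)) with hxkA
  set kA := prob p (hitsK ends T {b} ∩ avoidAll ends s (T ∪ A)) with hkA
  rw [gate_dual_identity]
  -- nonnegativity of the atoms
  have hr0 : 0 ≤ r := prob_nonneg hp _
  have hx0 : 0 ≤ x := prob_nonneg hp _
  have hy0 : 0 ≤ y := prob_nonneg hp _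
  have hkb0 : 0 ≤ kb := prob_nonneg hp _
  -- term 2: BHK 1.3
  have hD₂ : 0 ≤ r * xy - x * y := by
    have h := vdBK p hp ends s {a} {b} T T
    rw [Finset.inter_self, Finset.union_self] at h
    linarith [h]
  -- term 1: the hull-frame positive association given `R ∩ {K avoids b}`
  have hCov : 0 ≤ (r - kb) * xy - (x - xk) * y := by
    have h := hull_frame_pa p ends s T {b} a b hp
    have eY : connAll ends s {b} ∩ (avoidAll ends s T ∩ (hitsK ends T {b})ᶜ) =
        connAll ends s {b} ∩ avoidAll ends s T := by
      ext ω
      simp only [Set.mem_inter_iff, Set.mem_compl_iff]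
      exact ⟨fun ⟨hb, hR, _⟩ => ⟨hb, hR⟩,
        fun ⟨hb, hR⟩ => ⟨hb, hR, Y_inter_avoid_subset ends s T b ⟨hb, hR⟩⟩⟩
    have eXY : connAll ends s ({a} ∪ {b}) ∩ (avoidAll ends s T ∩ (hitsK ends T {b})ᶜ) =
        connAll ends s ({a} ∪ {b}) ∩ avoidAll ends s T := by
      rw [connAll_pair_eq]
      ext ω
      simp only [Set.mem_inter_iff, Set.mem_compl_iff]
      exact ⟨fun ⟨hab, hR, _⟩ => ⟨hab, hR⟩,
        fun ⟨hab, hR⟩ => ⟨hab, hR, Y_inter_avoid_subset ends s T b ⟨hab.2, hR⟩⟩⟩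
    have eX : prob p (connAll ends s {a} ∩ (avoidAll ends s T ∩ (hitsK ends T {b})ᶜ)) = x - xk := by
      have h2 := prob_inter_add_prob_inter_compl p (connAll ends s {a} ∩ avoidAll ends s T)
        (hitsK ends T {b})
      have e3 : connAll ends s {a} ∩ avoidAll ends s T ∩ hitsK ends T {b} =
          connAll ends s {a} ∩ hitsK ends T {b} ∩ avoidAll ends s T := by
        ext ω; simp only [Set.mem_inter_iff]; tauto
      have e4 : connAll ends s {a} ∩ avoidAll ends s T ∩ (hitsK ends T {b})ᶜ =
          connAll ends s {a} ∩ (avoidAll ends s T ∩ (hitsK ends T {b})ᶜ) := Set.inter_assoc _ _ _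
      rw [e3, e4] at h2
      linear_combination h2
    have eR : prob p (avoidAll ends s T ∩ (hitsK ends T {b})ᶜ) = r - kb := by
      have h2 := prob_inter_add_prob_inter_compl p (avoidAll ends s T) (hitsK ends T {b})
      rw [Set.inter_comm (avoidAll ends s T) (hitsK ends T {b})] at h2
      linear_combination h2
    rw [eY, eXY, eX, eR] at h
    linarith [h]
  -- term 3: the chain through the S-frame and two avoided-set shifts
  have hD₃ : 0 ≤ x * kA - r * xkA := by
    have hα := sframe_step p ends s T A a b hp
    have eK : hitsK ends T {b} ∩ avoidAll ends s (T ∪ A ∪ {b}) =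
        hitsK ends T {b} ∩ avoidAll ends s (T ∪ A) := by
      ext ω
      constructor
      · rintro ⟨hK, hR⟩
        exact ⟨hK, ((mem_avoid_union_singleton_iff ends s T A b ω).1 hR).1⟩
      · intro h
        exact ⟨h.1, hits_avoid_subset ends s T A b h⟩
    have eXK : connAll ends s {a} ∩ hitsK ends T {b} ∩ avoidAll ends s (T ∪ A ∪ {b}) =
        connAll ends s {a} ∩ hitsK ends T {b} ∩ avoidAll ends s (T ∪ A) := by
      ext ω
      constructor
      · rintro ⟨⟨ha, hK⟩, hR⟩
        exact ⟨⟨ha, hK⟩, ((mem_avoid_union_singleton_iff ends s T A b ω).1 hR).1⟩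
      · rintro ⟨⟨ha, hK⟩, hR⟩
        exact ⟨⟨ha, hK⟩, hits_avoid_subset ends s T A b ⟨hK, hR⟩⟩
    rw [eK, eXK] at hα
    have hγ := MineCLemmas.shift_avoid_more p ends hp s {a} (T ∪ A) {b}
    have hδ := MineCLemmas.shift_avoid_more p ends hp s {a} T A
    set r₁ := prob p (avoidAll ends s (T ∪ A ∪ {b})) with hr₁
    set rA := prob p (avoidAll ends s (T ∪ A)) with hrA
    set x₁ := prob p (connAll ends s {a} ∩ avoidAll ends s (T ∪ A ∪ {b})) with hx₁
    set xA := prob p (connAll ends s {a} ∩ avoidAll ends s (T ∪ A)) with hxA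
    have hr₁0 : 0 ≤ r₁ := prob_nonneg hp _
    have hrA0 : 0 ≤ rA := prob_nonneg hp _
    have hkA0 : 0 ≤ kA := prob_nonneg hp _
    have hxkA0 : 0 ≤ xkA := prob_nonneg hp _
    have hx₁0 : 0 ≤ x₁ := prob_nonneg hp _
    have hkAr : kA ≤ r₁ := by
      rw [hkA, hr₁]
      exact prob_mono hp (hits_avoid_subset ends s T A b)
    have hxkAk : xkA ≤ kA := prob_mono hp (Set.inter_subset_inter_left _ Set.inter_subset_right)
    rcases hr₁0.lt_or_eq with hpos | hzero
    · -- `xkA · r₁ · rA · r ≤ x · rA · r₁ · kA`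
      have h1 : xkA * r₁ * (rA * r) ≤ x₁ * kA * (rA * r) :=
        mul_le_mul_of_nonneg_right hα (mul_nonneg hrA0 hr0)
      have h2 : x₁ * kA * (rA * r) = (x₁ * rA) * (kA * r) := by ring
      have h3 : (x₁ * rA) * (kA * r) ≤ (xA * r₁) * (kA * r) :=
        mul_le_mul_of_nonneg_right hγ (mul_nonneg hkA0 hr0)
      have h4 : (xA * r₁) * (kA * r) = (xA * r) * (r₁ * kA) := by ring
      have h5 : (xA * r) * (r₁ * kA) ≤ (x * rA) * (r₁ * kA) :=
        mul_le_mul_of_nonneg_right hδ (mul_nonneg hr₁0 hkA0)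
      have hchain : xkA * r₁ * (rA * r) ≤ (x * rA) * (r₁ * kA) := by
        calc xkA * r₁ * (rA * r) ≤ x₁ * kA * (rA * r) := h1
          _ = (x₁ * rA) * (kA * r) := h2
          _ ≤ (xA * r₁) * (kA * r) := h3
          _ = (xA * r) * (r₁ * kA) := h4
          _ ≤ (x * rA) * (r₁ * kA) := h5
      have hprod : 0 ≤ (r₁ * rA) * (x * kA - r * xkA) := by nlinarith [hchain]
      rcases hrA0.lt_or_eq with hposA | hzeroA
      · exact nonneg_of_mul_nonneg_right hprod (mul_pos hpos hposA)
      · -- `rA = 0` forces `r₁ = 0` (contradiction with `hpos`) — via `r₁ ≤ rA`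
        have hle : r₁ ≤ rA := by
          rw [hr₁, hrA]
          refine prob_mono hp fun ω hω => ?_
          exact ((mem_avoid_union_singleton_iff ends s T A b ω).1 hω).1
        rw [← hzeroA] at hle
        linarith
    · have hkA' : kA = 0 := le_antisymm (hzero ▸ hkAr) hkA0
      have hxkA' : xkA = 0 := le_antisymm (hkA' ▸ hxkAk) hxkA0
      rw [hkA', hxkA']
      simp
  exact add_nonneg (add_nonneg (mul_nonneg hr0 hCov) (mul_nonneg hkb0 hD₂)) (mul_nonneg hy0 hD₃)

/-- The dual marker gate at `a` (the row is symmetric in `a ↔ b`): `GateRow p ends s T a b A {a}`. -/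
theorem GateRow_dual' (hp : IsProbVec p) : GateRow p ends s T a b A {a} := by
  have h := GateRow_dual p ends s T A b a hp
  unfold GateRow at h ⊢
  rw [Finset.union_comm] at h
  linarith [h]

end Main

end Gate

end Summit.Ventures.PercRepro2
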